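import Summits.HubbardSuperconductivity.HubbardSuperconductivity.Theses.ParentFirstSMA
import Summits.HubbardSuperconductivity.HubbardSuperconductivity.Theorems.ParentFirstSMAMottGap
import Summits.HubbardSuperconductivity.HubbardSuperconductivity.Theorems.ParentFirstSMABoundCoherentDWavePairsPairGapBinding
import Summits.HubbardSuperconductivity.HubbardSuperconductivity.Theorems.ParentFirstSMABoundCoherentDWavePairsMottGapWindow
import Summits.HubbardSuperconductivity.HubbardSuperconductivity.Theorems.ParentFirstSMABoundCoherentDWavePairsTwoSidedSingleMode
import Summits.HubbardSuperconductivity.HubbardSuperconductivity.Theorems.ParentFirstSMABoundCoherentDWavePairsPunchWave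
import Literature.MathematicalPhysics.QuantumLattice.HubbardModelParticleHoleProofs

/-!
# Crux `BoundCoherentDWavePairs` (stmt-HubbardSuperconductivity-10770) — line `birth`, skeleton rev c14

Route `ParentFirstSMA` (route-HubbardSuperconductivity-ParentFirstSMA) of
`HubbardSuperconductivity/HubbardSuperconductivity`, crux of rank 3
(`Summit.HubbardSuperconductivity.HubbardSuperconductivity.Theses.ParentFirstSMA.BoundCoherentDWavePairs`):
at SOME `U` in the window `12 ≤ U ≤ 24` (`t = 1`), uniformly in large even `L`,
(i) two doped holes BIND, `b ≤ Δ_b(L) := 2E(L²−1) − E(L²) − E(L²−2)` with `b > 0`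
(`E = groundEnergyAt (fermionTorusGraph 2 L) 1 U ·`), and (ii) the bound pair is
`d_{x²−y²}`-COHERENT, `z·L² ≤ |⟨φ₂, Δ_d ψ₀⟩|²` for some normalised ground states `φ₂`
(`(L²−2)`-sector) and `ψ₀` (half filling), `Δ_d = pairField dWaveFormFactor L`.

## The line (birth: continuum edge G → in-gap pair level P → d-wave residue R), rev c14

rev c14 (lead c14, 2026-08-17): the four glue stubs S1–S4 of rev c8 have LANDED as theorems
(`--supports stmt-HubbardSuperconductivity-10770`; p146391, p146392, p146214, p146488) and are now
IMPORTED; the remaining `sorry`s are exactly the three load-bearing stubs G, P, R of the planner's cut.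

The planner's cut (rev c1, sha 453f5171…) is kept verbatim — G `stub_parentMottGapWindow`,
P `stub_pairLevelInsideChargeGap`, R `stub_dWaveResidueOfGappedBoundPair`,
`BoundCoherentDWavePairs_of : G → P → R → crux` — and rev c8 REGISTERED, as further stubs,
the provable glue that the line consumes (all four landed in rev c14):

* `stub_pairGap_sub_eq_twice_binding` (S3): for even `L ≥ 2`,
  `2Δ_c(L) − Δ_p(L) = 2Δ_b(L)` EXACTLY (`Δ_p = E(L²+2) + E(L²−2) − 2E(L²)`), by the proved
  particle–hole identity `groundEnergyAt_fermionTorus_particleHole`; the composition now invokes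
  it instead of re-deriving it inline.
* `stub_parentMottGapWindow_of_holeSingleMode` (S1): crux #2 `HoleSingleModeBelowHalfU` BY NAME
  implies G (the first half of the route's deciding theorem `closes`, with the LANDED
  `Theorems.ParentFirstSMA.mottGapFromSingleMode_proof`). It makes G's status explicit:
  G = stmt-10769 + proved glue; the corollary `BoundCoherentDWavePairs_of_holeSingleMode` is the
  skeleton with G discharged that way.
* `stub_twoSidedSingleModeBinding` (S2): BOTH brackets of
  `Δ_b = [E(L²−1) − E(L²−2)] − [E(L²) − E(L²−1)]` are variational RELATIVE TO `E(L²−1)`: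
  for a one-hole ground state `φ` and doublon-commuting modes `A₁` (refill, `A₁φ` in sector `L²`)
  and `A₂` (punch, `A₂φ` in sector `L²−2`), Feynman's bound (`projectedSingleModeBound_proof`)
  twice gives `Z₁Z₂·Δ_b(L) ≥ −(Z₂f₁ + Z₁f₂)` (`Zᵢ = ‖Aᵢφ‖²`, `fᵢ = Re⟨Aᵢφ, [T, Aᵢ]φ⟩`, `U` drops
  out of both first moments). Binding is therefore an EQUAL-TIME FIRST-MOMENT INEQUALITY ON ONE
  STATE — the same shape as crux #2; the corollary `twoHoleBinding_of_firstMomentBudget` records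
  the resulting sufficient condition for clause (i).
* `stub_holePunchWave_commute_doublon` (S4): the punch modes `Σ_x c_x • c_{xσ}(1 − n_{xτ})`
  (`σ ≠ τ`; remove a `σ` electron from a singly occupied site) commute with the doublon number and
  lower the particle number by one — the analogue, for `A₂`, of the landed
  `holeWave_commute_doublon` / `isNParticle_holeWave_mulVec` used for crux #2's refill wave.

P and R are unchanged and remain the load-bearing, numerics-level claims (two-hole binding and
`d`-residue at `J/t = 4/U ∈ [1/6, 1/3]`); G is the route's parent claim (crux #2).
-/

-- `Summit.<Summit>.<Problem>`: for the single-conjunct summit the duplicate segment is mandated.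
set_option linter.dupNamespace false

namespace Summit.HubbardSuperconductivity.HubbardSuperconductivity.Cruxes.BoundCoherentDWavePairs.Birth

open scoped Matrix
open Literature.MathematicalPhysics.QuantumLattice
open Summit.HubbardSuperconductivity.HubbardSuperconductivity.Theses.ParentFirstSMA
open Summit.HubbardSuperconductivity.HubbardSuperconductivity.Theorems.ParentFirstSMA

/-! ## Registered stubs -/

/-- **Stub G — the parent Mott gap on the window.** For every `U` with `12 ≤ U ≤ 24` (`t = 1`)
there are `g > 0` and `L₀` such that every even `L ≥ L₀` has
`g ≤ Δ_c(L) = chargeGap (fermionTorusGraph 2 L) 1 U (L²) = E(L²+1) + E(L²−1) − 2E(L²)`.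
Verbatim hypothesis (a) of `DiluteDWavePairsCondense`; follows from `HoleSingleModeBelowHalfU`
(stmt-10769) by `stub_parentMottGapWindow_of_holeSingleMode`. Why it might fail as a THEOREM: no 2D
Mott-gap proof exists at any `U` (StrongCouplingCeiling). [cite: LiebWuPhysicaA2003, eq. (3)] -/
theorem stub_parentMottGapWindow :
    ∀ U : ℝ, 12 ≤ U → U ≤ 24 → ∃ g : ℝ, 0 < g ∧ ∃ L₀ : ℕ, ∀ L : ℕ, L₀ ≤ L → Even L →
      g ≤ chargeGap (fermionTorusGraph 2 L) 1 U (L ^ 2) := by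
  sorry

-- Stub S1 `stub_parentMottGapWindow_of_holeSingleMode` LANDED (p146391):
-- `Summit.HubbardSuperconductivity.HubbardSuperconductivity.Theorems.ParentFirstSMA.stub_parentMottGapWindow_of_holeSingleMode`
-- (module `Theorems.ParentFirstSMABoundCoherentDWavePairsMottGapWindow`), used below by its opened name.

/-- **Stub P — the pair level sits strictly inside the charge gap (clause (i) in gap form; the
`∃U` witness).** At some `U ∈ [12, 24]`: `Δ_p(L) + 2b ≤ 2Δ_c(L)` for all large even `L`, with
`Δ_p(L) = E(L²+2) + E(L²−2) − 2E(L²)` the two-particle and `Δ_c(L)` the one-particle charge gap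
at half filling; by `stub_pairGap_sub_eq_twice_binding` this is `b ≤ 2E(L²−1) − E(L²) − E(L²−2)`
(two-hole binding) exactly. Why plausibly true: two-hole `d_{x²−y²}` bound states throughout the
t-J window `J/t ∈ [1/6, 1/3]` (ED √20–32 sites, DMRG, series); why it might fail: binding
`≈ 0.1–0.3 t` shrinking with size, `t/J ≥ 3` past the series crossover.
[cite: doi:10.1103/RevModPhys.66.763] -/
theorem stub_pairLevelInsideChargeGap :
    ∃ U : ℝ, 12 ≤ U ∧ U ≤ 24 ∧ ∃ b : ℝ, 0 < b ∧ ∃ L₀ : ℕ, ∀ L : ℕ, L₀ ≤ L → Even L →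
      groundEnergyAt (fermionTorusGraph 2 L) 1 U (L ^ 2 + 2) +
            groundEnergyAt (fermionTorusGraph 2 L) 1 U (L ^ 2 - 2) -
            2 * groundEnergyAt (fermionTorusGraph 2 L) 1 U (L ^ 2) + 2 * b ≤
        2 * chargeGap (fermionTorusGraph 2 L) 1 U (L ^ 2) := by
  sorry

-- Stub S3 `stub_pairGap_sub_eq_twice_binding` LANDED (p146214):
-- `Summit.HubbardSuperconductivity.HubbardSuperconductivity.Theorems.ParentFirstSMA.stub_pairGap_sub_eq_twice_binding`
-- (module `Theorems.ParentFirstSMABoundCoherentDWavePairsPairGapBinding`), used below by its opened name.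

-- Stub S2 `stub_twoSidedSingleModeBinding` LANDED (p146392):
-- `Summit.HubbardSuperconductivity.HubbardSuperconductivity.Theorems.ParentFirstSMA.stub_twoSidedSingleModeBinding`
-- (module `Theorems.ParentFirstSMABoundCoherentDWavePairsTwoSidedSingleMode`), used below by its opened name.

-- Stub S4 `stub_holePunchWave_commute_doublon` LANDED (p146488):
-- `Summit.HubbardSuperconductivity.HubbardSuperconductivity.Theorems.ParentFirstSMA.stub_holePunchWave_commute_doublon`
-- (module `Theorems.ParentFirstSMABoundCoherentDWavePairsPunchWave`), used below by its opened name.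

/-- **Stub R — `d_{x²−y²}` residue of the bound pair in a gapped parent (clause (ii),
conditionally, for every `U` in the window).** If the parent is uniformly charge-gapped and two
holes bind uniformly at `U ∈ [12, 24]`, then for some `z > 0` and all large even `L` there are
normalised ground states `φ₂` (`(L²−2)`-sector) and `ψ₀` (half filling) of `hubbardTorus 2 L 1 U`
with `z·L² ≤ |⟨φ₂, pairField dWaveFormFactor L ψ₀⟩|²` — the two-hole ground multiplet contains a
zero-momentum `B₁` singlet whose pole on the bare `d`-pair carved from the parent has
`L`-uniform residue. Why it might fail: `p`-like or finite-momentum two-hole ground states on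
some even `L`; residue `→ 0` by spin-polaron dressing.
[cite: doi:10.1103/RevModPhys.66.763] -/
theorem stub_dWaveResidueOfGappedBoundPair :
    ∀ U : ℝ, 12 ≤ U → U ≤ 24 →
      (∃ g : ℝ, 0 < g ∧ ∃ L₀ : ℕ, ∀ L : ℕ, L₀ ≤ L → Even L →
          g ≤ chargeGap (fermionTorusGraph 2 L) 1 U (L ^ 2)) →
      (∃ b : ℝ, 0 < b ∧ ∃ L₀ : ℕ, ∀ L : ℕ, L₀ ≤ L → Even L →
          b ≤ 2 * groundEnergyAt (fermionTorusGraph 2 L) 1 U (L ^ 2 - 1) -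
            groundEnergyAt (fermionTorusGraph 2 L) 1 U (L ^ 2) -
            groundEnergyAt (fermionTorusGraph 2 L) 1 U (L ^ 2 - 2)) →
      ∃ z : ℝ, 0 < z ∧ ∃ L₀ : ℕ, ∀ (L : ℕ) [NeZero L], L₀ ≤ L → Even L →
        ∃ φ₂ ψ₀ : Fock (Orb (FermionTorus 2 L)),
          IsGroundState (hubbardTorus 2 L 1 U) (L ^ 2 - 2) φ₂ ∧ star φ₂ ⬝ᵥ φ₂ = 1 ∧
          IsGroundState (hubbardTorus 2 L 1 U) (L ^ 2) ψ₀ ∧ star ψ₀ ⬝ᵥ ψ₀ = 1 ∧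
          z * (L : ℝ) ^ 2 ≤ ‖star φ₂ ⬝ᵥ (pairField dWaveFormFactor L *ᵥ ψ₀)‖ ^ 2 := by
  sorry

/-! ## The composition (sorry-free modulo the stubs it names) -/

/-- P in gap form gives clause (i) (two-hole binding, same `b`, threshold `max L₀ 2`) by S3. -/
theorem twoHoleBinding_of_pairLevel
    (hS3 : ∀ (U : ℝ) (L : ℕ), Even L → 2 ≤ L →
      2 * chargeGap (fermionTorusGraph 2 L) 1 U (L ^ 2) -
          (groundEnergyAt (fermionTorusGraph 2 L) 1 U (L ^ 2 + 2) +
            groundEnergyAt (fermionTorusGraph 2 L) 1 U (L ^ 2 - 2) -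
            2 * groundEnergyAt (fermionTorusGraph 2 L) 1 U (L ^ 2)) =
        2 * (2 * groundEnergyAt (fermionTorusGraph 2 L) 1 U (L ^ 2 - 1) -
          groundEnergyAt (fermionTorusGraph 2 L) 1 U (L ^ 2) -
          groundEnergyAt (fermionTorusGraph 2 L) 1 U (L ^ 2 - 2)))
    {U b : ℝ} {L₀ : ℕ}
    (hP : ∀ L : ℕ, L₀ ≤ L → Even L →
      groundEnergyAt (fermionTorusGraph 2 L) 1 U (L ^ 2 + 2) +
            groundEnergyAt (fermionTorusGraph 2 L) 1 U (L ^ 2 - 2) -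
            2 * groundEnergyAt (fermionTorusGraph 2 L) 1 U (L ^ 2) + 2 * b ≤
        2 * chargeGap (fermionTorusGraph 2 L) 1 U (L ^ 2)) :
    ∀ L : ℕ, max L₀ 2 ≤ L → Even L →
      b ≤ 2 * groundEnergyAt (fermionTorusGraph 2 L) 1 U (L ^ 2 - 1) -
        groundEnergyAt (fermionTorusGraph 2 L) 1 U (L ^ 2) -
        groundEnergyAt (fermionTorusGraph 2 L) 1 U (L ^ 2 - 2) := by
  intro L hL hLeven
  have h := hP L (le_trans (le_max_left _ _) hL) hLeven
  have e := hS3 U L hLeven (le_trans (le_max_right _ _) hL)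
  linarith

/-- **Skeleton theorem: G → P → R → `BoundCoherentDWavePairs`, concluded BY NAME** (S3 supplies
the particle–hole conversion of P into clause (i)). -/
theorem BoundCoherentDWavePairs_of
    (hS3 : ∀ (U : ℝ) (L : ℕ), Even L → 2 ≤ L →
      2 * chargeGap (fermionTorusGraph 2 L) 1 U (L ^ 2) -
          (groundEnergyAt (fermionTorusGraph 2 L) 1 U (L ^ 2 + 2) +
            groundEnergyAt (fermionTorusGraph 2 L) 1 U (L ^ 2 - 2) -
            2 * groundEnergyAt (fermionTorusGraph 2 L) 1 U (L ^ 2)) =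
        2 * (2 * groundEnergyAt (fermionTorusGraph 2 L) 1 U (L ^ 2 - 1) -
          groundEnergyAt (fermionTorusGraph 2 L) 1 U (L ^ 2) -
          groundEnergyAt (fermionTorusGraph 2 L) 1 U (L ^ 2 - 2)))
    (hGap : ∀ U : ℝ, 12 ≤ U → U ≤ 24 → ∃ g : ℝ, 0 < g ∧ ∃ L₀ : ℕ, ∀ L : ℕ, L₀ ≤ L → Even L →
        g ≤ chargeGap (fermionTorusGraph 2 L) 1 U (L ^ 2))
    (hPair : ∃ U : ℝ, 12 ≤ U ∧ U ≤ 24 ∧ ∃ b : ℝ, 0 < b ∧ ∃ L₀ : ℕ, ∀ L : ℕ, L₀ ≤ L → Even L →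
        groundEnergyAt (fermionTorusGraph 2 L) 1 U (L ^ 2 + 2) +
              groundEnergyAt (fermionTorusGraph 2 L) 1 U (L ^ 2 - 2) -
              2 * groundEnergyAt (fermionTorusGraph 2 L) 1 U (L ^ 2) + 2 * b ≤
          2 * chargeGap (fermionTorusGraph 2 L) 1 U (L ^ 2))
    (hRes : ∀ U : ℝ, 12 ≤ U → U ≤ 24 →
        (∃ g : ℝ, 0 < g ∧ ∃ L₀ : ℕ, ∀ L : ℕ, L₀ ≤ L → Even L →
            g ≤ chargeGap (fermionTorusGraph 2 L) 1 U (L ^ 2)) →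
        (∃ b : ℝ, 0 < b ∧ ∃ L₀ : ℕ, ∀ L : ℕ, L₀ ≤ L → Even L →
            b ≤ 2 * groundEnergyAt (fermionTorusGraph 2 L) 1 U (L ^ 2 - 1) -
              groundEnergyAt (fermionTorusGraph 2 L) 1 U (L ^ 2) -
              groundEnergyAt (fermionTorusGraph 2 L) 1 U (L ^ 2 - 2)) →
        ∃ z : ℝ, 0 < z ∧ ∃ L₀ : ℕ, ∀ (L : ℕ) [NeZero L], L₀ ≤ L → Even L →
          ∃ φ₂ ψ₀ : Fock (Orb (FermionTorus 2 L)),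
            IsGroundState (hubbardTorus 2 L 1 U) (L ^ 2 - 2) φ₂ ∧ star φ₂ ⬝ᵥ φ₂ = 1 ∧
            IsGroundState (hubbardTorus 2 L 1 U) (L ^ 2) ψ₀ ∧ star ψ₀ ⬝ᵥ ψ₀ = 1 ∧
            z * (L : ℝ) ^ 2 ≤ ‖star φ₂ ⬝ᵥ (pairField dWaveFormFactor L *ᵥ ψ₀)‖ ^ 2) :
    BoundCoherentDWavePairs := by
  obtain ⟨U, hU12, hU24, b, hb, L₀, hL⟩ := hPair
  have hbind : ∃ b : ℝ, 0 < b ∧ ∃ L₀ : ℕ, ∀ L : ℕ, L₀ ≤ L → Even L →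
      b ≤ 2 * groundEnergyAt (fermionTorusGraph 2 L) 1 U (L ^ 2 - 1) -
        groundEnergyAt (fermionTorusGraph 2 L) 1 U (L ^ 2) -
        groundEnergyAt (fermionTorusGraph 2 L) 1 U (L ^ 2 - 2) :=
    ⟨b, hb, max L₀ 2, twoHoleBinding_of_pairLevel hS3 hL⟩
  exact ⟨U, hU12, hU24, hbind, hRes U hU12 hU24 (hGap U hU12 hU24) hbind⟩

/-- **The crux BY NAME from the named stubs** (hypothesis-free form; its only `sorry`s are the
`stub_*` it invokes: S3, G, P, R). -/
theorem BoundCoherentDWavePairs_of_stubs : BoundCoherentDWavePairs :=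
  BoundCoherentDWavePairs_of stub_pairGap_sub_eq_twice_binding stub_parentMottGapWindow
    stub_pairLevelInsideChargeGap stub_dWaveResidueOfGappedBoundPair

/-- **The crux with G discharged through crux #2**: `HoleSingleModeBelowHalfU → crux` modulo
S1, S3, P, R. -/
theorem BoundCoherentDWavePairs_of_holeSingleMode (hC1 : HoleSingleModeBelowHalfU) :
    BoundCoherentDWavePairs :=
  BoundCoherentDWavePairs_of stub_pairGap_sub_eq_twice_binding
    (stub_parentMottGapWindow_of_holeSingleMode hC1)
    stub_pairLevelInsideChargeGap stub_dWaveResidueOfGappedBoundPair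

/-! ## The first-moment form of clause (i) (documentation of the attack on P; sorry-free modulo S2) -/

/-- **Two-hole binding from a first-moment budget on the one-hole ground state.** If at `U` there
are `b > 0`, `L₀` and, for every even `L ≥ L₀`, a one-hole ground state `φ` with doublon-commuting
refill/punch modes `A₁`, `A₂` (sectors `L²`, `L²−2`) of positive norms `Z₁`, `Z₂` whose first
moments satisfy `Z₂f₁ + Z₁f₂ ≤ −b·Z₁Z₂`, then clause (i) holds at `U` with the same `b` — by S2.
This is the equal-time, one-state SUFFICIENT condition for binding (the shape of crux #2). -/
theorem twoHoleBinding_of_firstMomentBudget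
    (hS2 : ∀ (U : ℝ) (L : ℕ)
      (A₁ A₂ : Matrix (Finset (Orb (FermionTorus 2 L))) (Finset (Orb (FermionTorus 2 L))) ℂ)
      (φ : Fock (Orb (FermionTorus 2 L))),
      IsGroundState (hubbardTorus 2 L 1 U) (L ^ 2 - 1) φ →
      A₁ * (∑ x : FermionTorus 2 L, numberOp x 0 * numberOp x 1) =
        (∑ x : FermionTorus 2 L, numberOp x 0 * numberOp x 1) * A₁ →
      A₂ * (∑ x : FermionTorus 2 L, numberOp x 0 * numberOp x 1) =
        (∑ x : FermionTorus 2 L, numberOp x 0 * numberOp x 1) * A₂ →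
      IsNParticle (L ^ 2) (A₁ *ᵥ φ) → IsNParticle (L ^ 2 - 2) (A₂ *ᵥ φ) →
      -((star (A₂ *ᵥ φ) ⬝ᵥ (A₂ *ᵥ φ)).re *
            (star (A₁ *ᵥ φ) ⬝ᵥ ((hubbardTorus 2 L 1 0 * A₁ - A₁ * hubbardTorus 2 L 1 0) *ᵥ φ)).re +
          (star (A₁ *ᵥ φ) ⬝ᵥ (A₁ *ᵥ φ)).re *
            (star (A₂ *ᵥ φ) ⬝ᵥ ((hubbardTorus 2 L 1 0 * A₂ - A₂ * hubbardTorus 2 L 1 0) *ᵥ φ)).re) ≤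
        (star (A₁ *ᵥ φ) ⬝ᵥ (A₁ *ᵥ φ)).re * (star (A₂ *ᵥ φ) ⬝ᵥ (A₂ *ᵥ φ)).re *
          (2 * groundEnergyAt (fermionTorusGraph 2 L) 1 U (L ^ 2 - 1) -
            groundEnergyAt (fermionTorusGraph 2 L) 1 U (L ^ 2) -
            groundEnergyAt (fermionTorusGraph 2 L) 1 U (L ^ 2 - 2)))
    {U b : ℝ} {L₀ : ℕ}
    (hbudget : ∀ L : ℕ, L₀ ≤ L → Even L →
      ∃ (A₁ A₂ : Matrix (Finset (Orb (FermionTorus 2 L))) (Finset (Orb (FermionTorus 2 L))) ℂ)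
        (φ : Fock (Orb (FermionTorus 2 L))),
        IsGroundState (hubbardTorus 2 L 1 U) (L ^ 2 - 1) φ ∧
        A₁ * (∑ x : FermionTorus 2 L, numberOp x 0 * numberOp x 1) =
          (∑ x : FermionTorus 2 L, numberOp x 0 * numberOp x 1) * A₁ ∧
        A₂ * (∑ x : FermionTorus 2 L, numberOp x 0 * numberOp x 1) =
          (∑ x : FermionTorus 2 L, numberOp x 0 * numberOp x 1) * A₂ ∧
        IsNParticle (L ^ 2) (A₁ *ᵥ φ) ∧ IsNParticle (L ^ 2 - 2) (A₂ *ᵥ φ) ∧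
        0 < (star (A₁ *ᵥ φ) ⬝ᵥ (A₁ *ᵥ φ)).re ∧ 0 < (star (A₂ *ᵥ φ) ⬝ᵥ (A₂ *ᵥ φ)).re ∧
        (star (A₂ *ᵥ φ) ⬝ᵥ (A₂ *ᵥ φ)).re *
              (star (A₁ *ᵥ φ) ⬝ᵥ ((hubbardTorus 2 L 1 0 * A₁ - A₁ * hubbardTorus 2 L 1 0) *ᵥ φ)).re +
            (star (A₁ *ᵥ φ) ⬝ᵥ (A₁ *ᵥ φ)).re *
              (star (A₂ *ᵥ φ) ⬝ᵥ ((hubbardTorus 2 L 1 0 * A₂ - A₂ * hubbardTorus 2 L 1 0) *ᵥ φ)).re ≤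
          -b * ((star (A₁ *ᵥ φ) ⬝ᵥ (A₁ *ᵥ φ)).re * (star (A₂ *ᵥ φ) ⬝ᵥ (A₂ *ᵥ φ)).re)) :
    ∀ L : ℕ, L₀ ≤ L → Even L →
      b ≤ 2 * groundEnergyAt (fermionTorusGraph 2 L) 1 U (L ^ 2 - 1) -
        groundEnergyAt (fermionTorusGraph 2 L) 1 U (L ^ 2) -
        groundEnergyAt (fermionTorusGraph 2 L) 1 U (L ^ 2 - 2) := by
  intro L hL hLeven
  obtain ⟨A₁, A₂, φ, hGS, hA₁, hA₂, hN₁, hN₂, hZ₁, hZ₂, hf⟩ := hbudget L hL hLeven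
  have h := hS2 U L A₁ A₂ φ hGS hA₁ hA₂ hN₁ hN₂
  have hZZ : 0 < (star (A₁ *ᵥ φ) ⬝ᵥ (A₁ *ᵥ φ)).re * (star (A₂ *ᵥ φ) ⬝ᵥ (A₂ *ᵥ φ)).re :=
    mul_pos hZ₁ hZ₂
  by_contra hlt
  rw [not_le] at hlt
  nlinarith

/-- **The crux from a first-moment budget with the EXPLICIT single-site modes** (documentation of
the attack on P, sorry-free modulo S2, S4, G, R): if at some `U ∈ [12, 24]` there are `b > 0`,
`L₀` and, for every even `L ≥ L₀`, a one-hole ground state `φ` and coefficient functions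
`c₁ c₂ : Λ_L → ℂ` such that the refill wave `A₁ = Σ_x c₁ x • c†_{x↓}(1 − n_{x↑})` (crux #2's mode)
and the punch wave `A₂ = Σ_x c₂ x • c_{x↑}(1 − n_{x↓})` have positive norms on `φ` and first
moments with `Z₂f₁ + Z₁f₂ ≤ −b·Z₁Z₂`, then `BoundCoherentDWavePairs`. The budget is an equal-time
quadratic-form inequality on ONE state, certifiable configuration by configuration (ED census at
`L = 4` attached to the item). -/
theorem BoundCoherentDWavePairs_of_firstMomentBudget
    (hBudget : ∃ U : ℝ, 12 ≤ U ∧ U ≤ 24 ∧ ∃ b : ℝ, 0 < b ∧ ∃ L₀ : ℕ, ∀ L : ℕ, L₀ ≤ L → Even L →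
      ∃ (c₁ c₂ : FermionTorus 2 L → ℂ) (φ : Fock (Orb (FermionTorus 2 L))),
        IsGroundState (hubbardTorus 2 L 1 U) (L ^ 2 - 1) φ ∧
        (let A₁ : Matrix (Finset (Orb (FermionTorus 2 L))) (Finset (Orb (FermionTorus 2 L))) ℂ :=
            ∑ x : FermionTorus 2 L, c₁ x • (creation (orb x 1) * (1 - numberOp x 0))
          let A₂ : Matrix (Finset (Orb (FermionTorus 2 L))) (Finset (Orb (FermionTorus 2 L))) ℂ :=
            ∑ x : FermionTorus 2 L, c₂ x • (annihilation (orb x 0) * (1 - numberOp x 1))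
          0 < (star (A₁ *ᵥ φ) ⬝ᵥ (A₁ *ᵥ φ)).re ∧ 0 < (star (A₂ *ᵥ φ) ⬝ᵥ (A₂ *ᵥ φ)).re ∧
          (star (A₂ *ᵥ φ) ⬝ᵥ (A₂ *ᵥ φ)).re *
                (star (A₁ *ᵥ φ) ⬝ᵥ ((hubbardTorus 2 L 1 0 * A₁ - A₁ * hubbardTorus 2 L 1 0) *ᵥ φ)).re +
              (star (A₁ *ᵥ φ) ⬝ᵥ (A₁ *ᵥ φ)).re *
                (star (A₂ *ᵥ φ) ⬝ᵥ ((hubbardTorus 2 L 1 0 * A₂ - A₂ * hubbardTorus 2 L 1 0) *ᵥ φ)).re ≤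
            -b * ((star (A₁ *ᵥ φ) ⬝ᵥ (A₁ *ᵥ φ)).re * (star (A₂ *ᵥ φ) ⬝ᵥ (A₂ *ᵥ φ)).re))) :
    BoundCoherentDWavePairs := by
  obtain ⟨U, hU12, hU24, b, hb, L₀, hL⟩ := hBudget
  have hbind : ∃ b : ℝ, 0 < b ∧ ∃ L₀ : ℕ, ∀ L : ℕ, L₀ ≤ L → Even L →
      b ≤ 2 * groundEnergyAt (fermionTorusGraph 2 L) 1 U (L ^ 2 - 1) -
        groundEnergyAt (fermionTorusGraph 2 L) 1 U (L ^ 2) -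
        groundEnergyAt (fermionTorusGraph 2 L) 1 U (L ^ 2 - 2) := by
    refine ⟨b, hb, max L₀ 2, ?_⟩
    refine twoHoleBinding_of_firstMomentBudget stub_twoSidedSingleModeBinding (L₀ := max L₀ 2) ?_
    intro L hLL hLeven
    have hL₀ : L₀ ≤ L := le_trans (le_max_left _ _) hLL
    have hL2 : 2 ≤ L := le_trans (le_max_right _ _) hLL
    have h4 : 4 ≤ L ^ 2 := by
      calc (4 : ℕ) = 2 ^ 2 := by norm_num
        _ ≤ L ^ 2 := Nat.pow_le_pow_left hL2 2
    obtain ⟨c₁, c₂, φ, hGS, hZ₁, hZ₂, hf⟩ := hL L hL₀ hLeven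
    refine ⟨∑ x : FermionTorus 2 L, c₁ x • (creation (orb x 1) * (1 - numberOp x 0)),
      ∑ x : FermionTorus 2 L, c₂ x • (annihilation (orb x 0) * (1 - numberOp x 1)), φ, hGS,
      (holeWave_commute_doublon c₁).eq,
      ((stub_holePunchWave_commute_doublon L 0 1 (by decide) c₂).1).eq, ?_, ?_, hZ₁, hZ₂, hf⟩
    · have h := isNParticle_holeWave_mulVec c₁ hGS.1
      rwa [show L ^ 2 - 1 + 1 = L ^ 2 by omega] at h
    · have hφ : IsNParticle (L ^ 2 - 2 + 1) φ := by
        rw [show L ^ 2 - 2 + 1 = L ^ 2 - 1 by omega]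
        exact hGS.1
      exact (stub_holePunchWave_commute_doublon L 0 1 (by decide) c₂).2 (L ^ 2 - 2) φ hφ
  exact ⟨U, hU12, hU24, hbind, stub_dWaveResidueOfGappedBoundPair U hU12 hU24
    (stub_parentMottGapWindow U hU12 hU24) hbind⟩

end Summit.HubbardSuperconductivity.HubbardSuperconductivity.Cruxes.BoundCoherentDWavePairs.Birth
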